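import Summits.BirchSwinnertonDyer.BirchSwinnertonDyer.Theorems.ClassRecordThreeShimuraKolyvaginMinusOneSquare
import Literature.NumberTheory.EllipticCurves.HeegnerPointsKolyvaginConjugation
import Literature.NumberTheory.EllipticCurves.HeegnerPointsKolyvaginTorsionProofs
import Literature.NumberTheory.EllipticCurves.HeegnerPointsKolyvaginPrimaryPairingProofs
import HarnessLib

/-!
# `−1 ∈ ρ_{E,3^M}(Γ_K)` and `E(K)[3^∞] = 0` for EVERY quadratic field `K` and every `E/ℚ` with
# `E[3]` irreducible — NO surjectivity, NO condition on `d_K` (cell `bsd-stepL`, seat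
# `bsd-stepL-shim3b` g3; helper for the crux `ShimuraKolyvaginOrderBoundAtThreeSurj` = item
# stmt-BirchSwinnertonDyer-19899, the record item 19616 and the (T4″)@3 corner)

HONEST FRAMING (programme file §HONESTY, verbatim): «no tranche here proves BSD; ARM L moves the
LITERAL column of an r ≤ 1 census into the kernel-proved-modulo-named-print column; ARM P changes what
«named print» is worth. The residue (4.31 %) and every SUMMIT-BEARING rung (S0–S3) stay theorem-bound
and are staffed by the 22 routes, not by this programme.» THEOREMS ONLY (no definition, no named fact,
no `sorry`); nothing here is a BSD class theorem; no census label moves.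

## What this file does

From the prequel (`ShimuraKolyvaginMinusOneSquare.exists_sq_smul_eq_neg_three_of_irr`: `−1 = ρ̄(γ²)`
for some `γ ∈ Γ_ℚ` whenever `E[3]` is irreducible) and `[Γ_ℚ : Γ_K] = 2` (every square of `Γ_ℚ`
restricts from `Γ_K`: `index_range_absGaloisRestrict_eq_finrank`, `exists_resGal_eq_mul_self`):

* §3 **`exists_smul_eq_neg_three_of_irr_of_finrank_eq_two`** / **`…_three_pow_…`** /
  **`…_of_isImaginaryQuadratic`** — for EVERY quadratic field `K`: some `z ∈ Γ_K` acts as `−1` on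
  `E(K̄)[3]`, and `z^{3^{M−1}}` as `−1` on `E(K̄)[3^M]` (`M ≥ 1`; transport
  `RatClosure.torsionEquiv`, level raising `smul_eq_neg_geomTorsion_pow`). This is the input `hz` of
  the tree's pairing machine (`KolyvaginPairing.eq_zero_of_h1Eval_eq_zero`,
  `…exists_h1Eval_eq_of_indep`; McCallum 1991 §3 / Gross 1991 Prop. 9.1 «the central subgroup
  `Z ≠ 1`») at `p = 3` under `Irr` ALONE — today supplied only from `ρ̄_{E,p}` onto
  (`KolyvaginImage.exists_smul_eq_neg` with `RatClosure.exists_smul_eq_of_sq`).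
* §4 **`torsionBy_three_pow_eq_bot_of_irr`** (any universe), **`…_type`**,
  **`torsionBy_three_eq_bot_of_irr_of_isImaginaryQuadratic`**, **`eq_zero_of_three_pow_nsmul_eq_zero_of_irr`**
  — `E(K)[3^M] = 0` for every quadratic number field `K` and every `E/ℚ` with `E[3]` irreducible:
  the `p = 3`, all-levels, `Irr`-only twin of the leaf `Gross1991_torsionBy_eq_bot` =
  `torsionBy_eq_bot_of_isImaginaryQuadratic` (Gross 1991 §2, sentence after (2.2), which needs
  `ρ̄_{E,p}` onto); same pull-back argument (`pointsMap`, `exists_resGal_eq_mul_self`) with the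
  transvection replaced by the square root of `−1` (`sq_pow_smul_eq_neg_three_pow`).

Why it matters for the crux: both halves of the old crux 19616 (`Surj` = item 19899, and the record
half `¬Surj ∧ Irr`, images `N(C_s)`, `N(C_ns)`) and the (T4″)@3 corner (`X11b.Three.CornerUpperAt`,
`¬ Surj W 3`) run the SAME Kolyvagin argument over `K`; this file makes its `−1`-input and its
torsion leaf image-uniform in the kernel (Matar–Nekovář 2019 Cor. 5.21 (e′) / Prop. 5.26 (2), Cha 2005
Lemmas 22–23 «the surjectivity assumption is needed (and nowhere else) to prove that f is injective»).
NOT claimed: simplicity and scalar commutant of `E[3]` as a `Γ_K`-module without surjectivity — they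
FAIL for the quadratic field inside `ℚ(E[3])` cut out by a Cartan in its normaliser and hold under
`K ⊄ ℚ(E[3])` (e.g. `(d_K, 3N) = 1`), which is ramification theory not formalised here; `p ≥ 5`; any
class theorem of BSD type.

References: [GrossLMS1991] §2 (after (2.2)), §9 Prop. 9.1; [McCallumLMS1991] §3; [Serre1972] §2.5;
[MatarNekovar2019] Cor. 5.21 (e′), Prop. 5.26 (2); [Cha2005] Lemmas 22–23.
-/

set_option autoImplicit false

set_option linter.dupNamespace false -- the Theorems namespace repeats the summit name, as in every sibling

noncomputable section

open scoped Classical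

open Field WeierstrassCurve
  Literature.NumberTheory.EllipticCurves Literature.NumberTheory.GaloisRepresentations
  Literature.NumberTheory.EllipticCurves.Rank1Residual
  Summit.BirchSwinnertonDyer.Rank1Residual.GaloisImage
  Summit.BirchSwinnertonDyer.BirchSwinnertonDyer.Theorems.ShimuraKolyvaginMinusOneSquare

universe u

namespace Summit.BirchSwinnertonDyer.BirchSwinnertonDyer.Theorems.ShimuraKolyvaginImageOverK

/-! ## §2′. Level raising on the `ℚ̄`-side -/

section RatSide

variable (W : WeierstrassCurve ℚ)

/-- Level raising on the `ℚ̄`-side: if `γ²` acts as `−1` on `E[3]` then `(γ^{3^{M−1}})²` acts as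
`−1` on `E[3^M]` (`M ≥ 1`; tree `KolyvaginPairing.smul_eq_neg_of_smul_eq_neg_torsionBy` for the
element `γ²`). [folklore] -/
theorem sq_pow_smul_eq_neg_three_pow {γ : absoluteGaloisGroup ℚ}
    (hγ : ∀ P : geomTorsion W ((3 : ℕ) : ℤ), γ • γ • P = -P) {M : ℕ} (hM : 1 ≤ M)
    (P : geomTorsion W ((3 ^ M : ℕ) : ℤ)) :
    (γ ^ 3 ^ (M - 1)) • (γ ^ 3 ^ (M - 1)) • P = -P := by
  have hz : ∀ t : geomPoints W, ((3 : ℕ) : ℤ) • t = 0 → (γ * γ) • t = -t := fun t ht => by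
    have := congrArg Subtype.val (hγ ⟨t, (Submodule.mem_torsionBy_iff _ _).mpr ht⟩)
    simpa only [AddSubgroup.torsionBy.coe_smul, NegMemClass.coe_neg, mul_smul] using this
  have hP : (((3 : ℕ) : ℤ) ^ M) • (P : geomPoints W) = 0 := by
    have := (Submodule.mem_torsionBy_iff _ _).mp P.2
    simpa only [Nat.cast_pow] using this
  have h := KolyvaginPairing.smul_eq_neg_of_smul_eq_neg_torsionBy (p := 3) (by decide) hz hM hP
  apply Subtype.ext
  rw [AddSubgroup.torsionBy.coe_smul, AddSubgroup.torsionBy.coe_smul, NegMemClass.coe_neg,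
    ← mul_smul, ← (Commute.refl γ).mul_pow]
  exact h

end RatSide

/-! ## §3. Over a quadratic field `K`: `−1 ∈ ρ̄_{E,3}(Γ_K)` and `−1 ∈ ρ_{E,3^M}(Γ_K)`, no surjectivity -/

section OverK

variable (W : WeierstrassCurve ℚ) [W.IsElliptic] (K : Type u) [Field K] [NumberField K]

/-- **For EVERY quadratic field `K` and every `E/ℚ` with `E[3]` irreducible, some `z ∈ Γ_K` acts as
`−1` on `E(K̄)[3]`** — the input `hz` of the tree's Kolyvagin pairing machine
(`KolyvaginPairing.eq_zero_of_h1Eval_eq_zero`, `…exists_h1Eval_eq_of_indep`) at `p = 3` WITHOUT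
`ρ̄_{E,3}` onto: `−1 = ρ̄(γ²)` (§2) and `γ² ∈ Γ_K` since `[Γ_ℚ : Γ_K] = 2`
(`index_range_absGaloisRestrict_eq_finrank`); transport along `RatClosure.torsionEquiv`.
(For `ρ̄` onto this is `KolyvaginImage.exists_smul_eq_neg` with `RatClosure.exists_smul_eq_of_sq`.)
[cite: GrossLMS1991, §9 Prop. 9.1] [cite: MatarNekovar2019, Cor. 5.21 (e′) and Prop. 5.26 (2)] -/
theorem exists_smul_eq_neg_three_of_irr_of_finrank_eq_two [Fact (Nat.Prime 3)]
    (hK : Module.finrank ℚ K = 2) (hirr : Irr W 3) :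
    ∃ z : absoluteGaloisGroup K, ∀ Q : geomTorsion (W.baseChange K) ((3 : ℕ) : ℤ), z • Q = -Q := by
  obtain ⟨γ, hγ⟩ := exists_sq_smul_eq_neg_three_of_irr W hirr
  set H := (absGaloisRestrict ℚ K).range with hH
  have hHi : H.index = 2 := (index_range_absGaloisRestrict_eq_finrank ℚ K).trans hK
  haveI : H.Normal := Subgroup.normal_of_index_eq_two hHi
  haveI : H.FiniteIndex := ⟨by rw [hHi]; decide⟩
  obtain ⟨g, hg⟩ : γ ^ 2 ∈ H := by
    have := Subgroup.pow_index_mem H γ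
    rwa [hHi] at this
  refine ⟨g, fun Q => ?_⟩
  set θ := RatClosure.torsionEquiv (K := K) W ((3 : ℕ) : ℤ) with hθ
  obtain ⟨P, rfl⟩ := θ.surjective Q
  change (absGaloisRestrict ℚ K) g = γ ^ 2 at hg
  rw [← RatClosure.torsionEquiv_smul, hg, pow_two, mul_smul, hγ, map_neg]

/-- **`−1 ∈ ρ_{E,3^M}(Γ_K)` for every quadratic `K`, every `M ≥ 1`, every `E/ℚ` with `E[3]`
irreducible**: some `z ∈ Γ_K` acts as `−1` on `E(K̄)[3^M]` (the level-`3` element raised to the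
power `3^{M−1}`, tree `smul_eq_neg_geomTorsion_pow`). No condition on the `3`-adic image, none on
`d_K`. [cite: McCallumLMS1991, §3 (standing hypothesis used on E_p only)] -/
theorem exists_smul_eq_neg_three_pow_of_irr_of_finrank_eq_two [Fact (Nat.Prime 3)]
    (hK : Module.finrank ℚ K = 2) (hirr : Irr W 3) {M : ℕ} (hM : 1 ≤ M) :
    ∃ z : absoluteGaloisGroup K,
      ∀ Q : geomTorsion (W.baseChange K) ((3 ^ M : ℕ) : ℤ), z • Q = -Q := by
  obtain ⟨z, hz⟩ := exists_smul_eq_neg_three_of_irr_of_finrank_eq_two W K hK hirr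
  exact ⟨z ^ 3 ^ (M - 1), fun Q =>
    smul_eq_neg_geomTorsion_pow (W.baseChange K) (by decide : Odd 3) hM hz Q⟩

/-- The imaginary-quadratic form (the machine's standing shape `IsImaginaryQuadratic K`): some
`z ∈ Γ_K` acts as `−1` on `E(K̄)[3^M]`, `M ≥ 1`, for `E[3]` irreducible.
[cite: GrossLMS1991, §9 Prop. 9.1] -/
theorem exists_smul_eq_neg_three_pow_of_irr_of_isImaginaryQuadratic [Fact (Nat.Prime 3)]
    (hK : IsImaginaryQuadratic K) (hirr : Irr W 3) {M : ℕ} (hM : 1 ≤ M) :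
    ∃ z : absoluteGaloisGroup K,
      ∀ Q : geomTorsion (W.baseChange K) ((3 ^ M : ℕ) : ℤ), z • Q = -Q :=
  exists_smul_eq_neg_three_pow_of_irr_of_finrank_eq_two W K hK.1 hirr hM

end OverK

/-! ## §4. `E(K)[3^∞] = 0` for every quadratic `K` under `Irr` alone -/

section Torsion

variable (K : Type) [Field K] [NumberField K] (W : WeierstrassCurve ℚ) [W.IsElliptic]

/-- **`E(K)[3^M] = 0` for a quadratic number field `K` (in `Type`) when `E[3]` is irreducible**
(`M ≥ 1`). Pull a `K`-rational `3^M`-torsion point back to `Q ∈ E(ℚ̄)` fixed by `res(Γ_K)`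
(`pointsMap`, `exists_resGal_eq_mul_self`: all squares of `Γ_ℚ` restrict from `Γ_K`); the square
`(γ^{3^{M−1}})²` of §2 acts as `−1`, so `Q = −Q`, `Q = 0`. The argument of
`torsionBy_eq_bot_of_hasSurjectiveModNGaloisRep_type` with surjectivity replaced by §2.
[cite: GrossLMS1991, §2 (sentence after (2.2))] -/
theorem torsionBy_three_pow_eq_bot_of_irr_type [Fact (Nat.Prime 3)] (hK : Module.finrank ℚ K = 2)
    (hirr : Irr W 3) {M : ℕ} (hM : 1 ≤ M) :
    AddSubgroup.torsionBy (W.baseChange K).toAffine.Point ((3 ^ M : ℕ) : ℤ) = ⊥ := by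
  rw [eq_bot_iff]
  intro P hP
  rw [AddSubgroup.mem_bot]
  have hPp : ((3 ^ M : ℕ) : ℤ) • P = 0 := (Submodule.mem_torsionBy_iff _ _).mp hP
  -- the point over `K̄` and its preimage `Q` over `ℚ̄`
  let f : K →ₐ[ℚ] AlgebraicClosure K := (algebraMap K (AlgebraicClosure K)).toRatAlgHom
  let φ : (W.baseChange K).toAffine.Point →+ localPoints W K :=
    WeierstrassCurve.Affine.Point.map f
  have hφ : Function.Injective φ := WeierstrassCurve.Affine.Point.map_injective _
  obtain ⟨Q, hQ⟩ := (pointsMapOfEmb_bijective K W (closureEmb (K := ℚ) K)).2 (φ P)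
  have hQ' : pointsMap W K Q = φ P := hQ
  have hinj : Function.Injective (pointsMap W K) :=
    (pointsMapOfEmb_bijective K W (closureEmb (K := ℚ) K)).1
  have hQp : ((3 ^ M : ℕ) : ℤ) • Q = 0 := by
    apply hinj
    rw [map_zsmul, map_zero, hQ', ← map_zsmul, hPp, map_zero]
  -- `Q` is fixed by `Γ_K`, hence by all squares of `Γ_ℚ`
  have hfixK : ∀ τ : absoluteGaloisGroup K, resGal (K := ℚ) K τ • Q = Q := by
    intro τ
    apply hinj
    rw [pointsMap_smul, hQ']
    change WeierstrassCurve.Affine.Point.map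
        ((AlgEquiv.restrictScalars ℚ (absoluteGaloisGroup.toAlgEquiv K τ) :
            AlgebraicClosure K ≃ₐ[ℚ] AlgebraicClosure K) :
          AlgebraicClosure K →ₐ[ℚ] AlgebraicClosure K)
        (WeierstrassCurve.Affine.Point.map f P) =
      WeierstrassCurve.Affine.Point.map f P
    have hgf : ((AlgEquiv.restrictScalars ℚ (absoluteGaloisGroup.toAlgEquiv K τ) :
            AlgebraicClosure K ≃ₐ[ℚ] AlgebraicClosure K) :
          AlgebraicClosure K →ₐ[ℚ] AlgebraicClosure K).comp f = f := by
      ext x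
      exact (absoluteGaloisGroup.toAlgEquiv K τ).commutes x
    rw [WeierstrassCurve.Affine.Point.map_map, hgf]
  have hsq : ∀ σ : absoluteGaloisGroup ℚ, (σ * σ) • Q = Q := by
    intro σ
    obtain ⟨τ, hτ⟩ := exists_resGal_eq_mul_self K hK σ
    rw [← hτ]
    exact hfixK τ
  -- the square `(γ^{3^{M-1}})²` acts as `−1` on `E[3^M] ∋ Q`
  obtain ⟨γ, hγ⟩ := exists_sq_smul_eq_neg_three_of_irr W hirr
  let Qm : geomTorsion W ((3 ^ M : ℕ) : ℤ) := ⟨Q, (Submodule.mem_torsionBy_iff _ _).mpr hQp⟩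
  have hneg := sq_pow_smul_eq_neg_three_pow W hγ hM Qm
  have hval : (γ ^ 3 ^ (M - 1) * γ ^ 3 ^ (M - 1)) • Q = -Q := by
    have := congrArg Subtype.val hneg
    simpa only [AddSubgroup.torsionBy.coe_smul, NegMemClass.coe_neg, mul_smul] using this
  rw [hsq] at hval
  -- `Q = −Q` and `3^M Q = 0` force `Q = 0`
  have hQ0 : Q = 0 := by
    have h2 : (2 : ℤ) • Q = 0 := by
      rw [two_zsmul]
      nth_rewrite 2 [hval]
      exact add_neg_cancel Q
    have hcop : IsCoprime (2 : ℤ) ((3 ^ M : ℕ) : ℤ) := by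
      rw [Nat.cast_pow, Nat.cast_ofNat]
      exact (Int.isCoprime_iff_gcd_eq_one.mpr (by norm_num)).pow_right
    obtain ⟨a, b, hab⟩ := hcop
    calc Q = (1 : ℤ) • Q := (one_zsmul Q).symm
      _ = (a * 2 + b * ((3 ^ M : ℕ) : ℤ)) • Q := by rw [hab]
      _ = 0 := by rw [add_zsmul, mul_zsmul, mul_zsmul, h2, hQp, zsmul_zero, zsmul_zero, add_zero]
  apply hφ
  rw [map_zero, ← hQ', hQ0, map_zero]

/-- **`E(K)[3^M] = 0` for every quadratic number field `K` (any universe) and every `E/ℚ` with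
`E[3]` irreducible** (`M ≥ 1`): universe descent through a primitive element
(`exists_algEquiv_numberField_type`, `torsionBy_eq_bot_of_algEquiv`). The `Irr`-only, all-levels,
`p = 3` twin of `torsionBy_eq_bot_of_hasSurjectiveModNGaloisRep`.
[cite: GrossLMS1991, §2 (sentence after (2.2))] -/
theorem torsionBy_three_pow_eq_bot_of_irr [Fact (Nat.Prime 3)] (L : Type u) [Field L] [NumberField L]
    (hL : Module.finrank ℚ L = 2) (hirr : Irr W 3) {M : ℕ} (hM : 1 ≤ M) :
    AddSubgroup.torsionBy (W.baseChange L).toAffine.Point ((3 ^ M : ℕ) : ℤ) = ⊥ := by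
  obtain ⟨K₀, _, _, ⟨e⟩⟩ := exists_algEquiv_numberField_type L
  have hK₀ : Module.finrank ℚ K₀ = 2 := by rw [← hL]; exact e.toLinearEquiv.finrank_eq
  exact torsionBy_eq_bot_of_algEquiv W e (p := 3 ^ M)
    (torsionBy_three_pow_eq_bot_of_irr_type K₀ W hK₀ hirr hM)

/-- **`E(K)[3] = 0` for `K` imaginary quadratic and `E[3]` irreducible** — literally the conclusion
of the leaf `Gross1991_torsionBy_eq_bot W K` (`torsionBy_eq_bot_of_isImaginaryQuadratic`) at `p = 3`
with its hypothesis `ρ̄_{E,3}` onto weakened to irreducible.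
[cite: GrossLMS1991, §2 (sentence after (2.2))] -/
theorem torsionBy_three_eq_bot_of_irr_of_isImaginaryQuadratic [Fact (Nat.Prime 3)] (L : Type u)
    [Field L] [NumberField L] (hL : IsImaginaryQuadratic L) (hirr : Irr W 3) :
    AddSubgroup.torsionBy (W.baseChange L).toAffine.Point ((3 : ℕ) : ℤ) = ⊥ := by
  have := torsionBy_three_pow_eq_bot_of_irr W L hL.1 hirr (M := 1) le_rfl
  simpa only [pow_one] using this

/-- **No `K`-rational point of `3`-power order** (elementwise form): for `K` quadratic and `E[3]`
irreducible, a point `P ∈ E(K)` with `3^M • P = 0` is `0`. [cite: GrossLMS1991, §2 (after (2.2))] -/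
theorem eq_zero_of_three_pow_nsmul_eq_zero_of_irr [Fact (Nat.Prime 3)] (L : Type u) [Field L]
    [NumberField L] (hL : Module.finrank ℚ L = 2) (hirr : Irr W 3) {M : ℕ}
    {P : (W.baseChange L).toAffine.Point} (hP : (3 ^ M : ℕ) • P = 0) : P = 0 := by
  rcases Nat.eq_zero_or_pos M with rfl | hM
  · simpa using hP
  · have hmem : P ∈ AddSubgroup.torsionBy (W.baseChange L).toAffine.Point ((3 ^ M : ℕ) : ℤ) :=
      (Submodule.mem_torsionBy_iff _ _).mpr (by rw [natCast_zsmul]; exact hP)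
    rw [torsionBy_three_pow_eq_bot_of_irr W L hL hirr hM] at hmem
    exact (AddSubgroup.mem_bot).mp hmem

end Torsion

end Summit.BirchSwinnertonDyer.BirchSwinnertonDyer.Theorems.ShimuraKolyvaginImageOverK

end
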